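import Summits.Langlands.Langlands.Theorems.IrreducibilityBySelfDualityReciprocityUpToIrreducibilityAboveUnramified
import Literature.NumberTheory.Automorphic.BaseChangeStrongUnramifiedRankOne
import HarnessLib

/-!
# Line `Sketch` for the crux `ReciprocityUpToIrreducibility` (item stmt-Langlands-14328), continuation c4:
# Satake parameters of the `GL₁` model `ℂ·(θ ∘ det)/⊥` at EVERY unramified place of `θ`

Support file (closes nothing; registered stub `stub_rankOne_hasSatakeParamAt_of_isUnramifiedAt` of
line `Sketch`, continuation lead c4, prover-line-stmt-Langlands-14328-c4-0, §1f "rank one: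
local–global compatibility at the unramified places of a Hecke character").

For a Hecke character `θ` of the number field `K`, the explicit Borel–Jacquet datum
`π_θ = ℂ·(θ ∘ det)/⊥` of `GL₁(𝔸_K)` (hypotheses `hW`, `hW'`) has Satake parameter `{θ(⟨ϖ⟩_v)}` at
every finite place `v` at which `θ` is UNRAMIFIED (`HeckeCharacter.IsUnramifiedAt`: the local
component `θ_v` kills `𝒪_vˣ`), for every uniformizer `ϖ` of `K_v`.  The tree's
`AutomorphicRepData.hasSatakeParamAt_detTwist_glOne` gives this only off SOME level `𝔪` of `θ`
(`HeckeCharacter.exists_level_glOne`), whose prime factors may contain unramified places; the defect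
is removed by the level-splitting `𝔪 = 𝔭_v^k 𝔪'`, `v ∤ 𝔪'` of
`Literature.NumberTheory.Automorphic.exists_level_not_dvd` and the averaging argument of
`AutomorphicRepData.hasSatakeParamAt_glOne_of_isUnramifiedAt` (`BaseChangeStrongUnramifiedRankOne`,
§2: a `GL₁` datum with Hecke character `χ` unramified at `w` has Satake parameter `{χ(ϖ_w)}` at `w`),
fed with "`θ` is the Hecke character of `π_θ`" (`heckeCharacter_detTwist_glOne`:
`r(g) φ - θ(det g) φ = 0` on `W = ℂ·(θ ∘ det)`).

* `hasSatakeParamAt_detTwist_glOne_of_isUnramifiedAt` — the statement with implicit arguments;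
* `stub_rankOne_hasSatakeParamAt_of_isUnramifiedAt` — the registered stub (closed form).

No definitions; standard axioms only.
-/

noncomputable section

set_option linter.dupNamespace false -- project-wide option (lakefile weak.linter.dupNamespace); `Summit.Langlands.Langlands` is the mandated namespace

open scoped MatrixGroups Matrix NumberField Classical Polynomial
open Filter IsDedekindDomain Field Polynomial
open Literature.NumberTheory.Automorphic Literature.NumberTheory.GaloisRepresentations
open Literature.NumberTheory.PAdicHodge
open Summit.Langlands

namespace Summit.Langlands.Langlands.Theorems.ReciprocityUpToIrreducibility

section RankOne

variable {K : Type} [Field K] [NumberField K] {hcpt₁ : isCompact_glFiniteIntegralLevel 1 K}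
  {π : AutomorphicRepData (AutomorphyDatum.gl 1 K hcpt₁)} {θ : HeckeCharacter K}

/-- **Satake parameters of `π_θ = ℂ·(θ ∘ det)/⊥` at the unramified places of `θ`.**  If `θ` is
unramified at the finite place `v` (`θ_v(𝒪_vˣ) = 1`), then for every uniformizer `ϖ` of `K_v` the
datum `π_θ` has Satake parameter `{θ(⟨ϖ⟩_v)}` at `v`: `GL₁(𝔸_K)` acts on `W = ℂ·(θ ∘ det)` through
`θ ∘ det` (`heckeCharacter_detTwist_glOne`), so
`AutomorphicRepData.hasSatakeParamAt_glOne_of_isUnramifiedAt` applies (a level `K(𝔪₀)` of a form is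
split as `𝔪₀ = 𝔭_v^k 𝔪`, `v ∤ 𝔪`, and the form is averaged over `K(𝔪)/K(𝔪) ∩ K(𝔪₀)`, on which
`θ ∘ det = θ_v ∘ det_v = 1` by unramifiedness).  Tate (1950), §2.3 (unramified quasi-characters);
Borel–Jacquet 1979, 4.6. [cite: BorelJacquet1979, 4.6] [cite: TateThesis1967, §2.3] -/
theorem hasSatakeParamAt_detTwist_glOne_of_isUnramifiedAt
    (hW : π.W = Submodule.span ℂ {fun g : (AdelicGroupData.gl 1 K).Adelic => (detTwist 1 θ g : ℂ)})
    {v : HeightOneSpectrum (𝓞 K)} (hv : θ.IsUnramifiedAt v) {ϖ : (v.adicCompletion K)ˣ}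
    (hϖ : Valued.v (ϖ : v.adicCompletion K) = WithZero.exp (-1 : ℤ)) :
    π.HasSatakeParamAt v {((θ (localUnits v ϖ) : ℂˣ) : ℂ)} :=
  π.hasSatakeParamAt_glOne_of_isUnramifiedAt (heckeCharacter_detTwist_glOne hW) hv hϖ

end RankOne

/-- **Registered stub `stub_rankOne_hasSatakeParamAt_of_isUnramifiedAt` of line `Sketch` (crux
stmt-Langlands-14328, c4), closed form of `hasSatakeParamAt_detTwist_glOne_of_isUnramifiedAt`.**
For every number field `K`, Hecke character `θ` and Borel–Jacquet datum `π = ℂ·(θ ∘ det)/⊥` of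
`GL₁(𝔸_K)`: at every finite place `v` where `θ` is unramified and for every uniformizer `ϖ` of
`K_v`, `π` has Satake parameter `{θ(⟨ϖ⟩_v)}` at `v` (the hypothesis `W' = ⊥` is not needed).
[cite: BorelJacquet1979, 4.6] [cite: TateThesis1967, §2.3] -/
theorem stub_rankOne_hasSatakeParamAt_of_isUnramifiedAt :
    ∀ (K : Type) [Field K] [NumberField K] (hcpt : isCompact_glFiniteIntegralLevel 1 K)
      (θ : HeckeCharacter K) (π : AutomorphicRepData (AutomorphyDatum.gl 1 K hcpt)),
      π.W = Submodule.span ℂ {fun g : (AdelicGroupData.gl 1 K).Adelic => (detTwist 1 θ g : ℂ)} →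
      π.W' = ⊥ →
      ∀ (v : HeightOneSpectrum (𝓞 K)), θ.IsUnramifiedAt v →
        ∀ (ϖ : (v.adicCompletion K)ˣ), Valued.v (ϖ : v.adicCompletion K) = WithZero.exp (-1 : ℤ) →
          π.HasSatakeParamAt v {((θ (localUnits v ϖ) : ℂˣ) : ℂ)} :=
  fun _ _ _ _ _ _ hW _ _ hv _ hϖ => hasSatakeParamAt_detTwist_glOne_of_isUnramifiedAt hW hv hϖ

end Summit.Langlands.Langlands.Theorems.ReciprocityUpToIrreducibility

end
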